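import Literature.Geometry.Kaehler.FibrePrimitiveProduct
import Literature.Geometry.Kaehler.LinearHomotopyOperatorLocal
import HarnessLib

/-!
# The fibre primitive on `N × ℝ` is smooth and a primitive (relative Poincaré lemma)

Continuation of `FibrePrimitiveProduct.lean` (the fibre primitive
`fibrePrimitive η (n, t) = ∫₀¹ H_σ^* (ι_{(0,t)} η (n, σt)) dσ` of a form on `N × ℝ` and its chart
identity) with the localised flat results of `LinearHomotopyOperatorLocal.lean`:

* `inChart_fibrePrimitive_eq` — the chart identity `(fibrePrimitive η).inChart x₀ = K (η.inChart x₀)`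
  on the whole chart target, with no integrability hypothesis (the coordinate change `τ × id` is a
  continuous linear EQUIVALENCE and passes through the integral);
* `smoothAt_fibrePrimitive` — for `J ⊆ ℝ` open and star-shaped at `0` and `η` smooth on `N × J`,
  the fibre primitive is smooth on `N × J`;
* **`mextDeriv_fibrePrimitive`** — if moreover `η` is closed on `N × J` and vanishes on `N × {0}`,
  then `d (fibrePrimitive η) = η` on `N × J`.

Together with `fibrePrimitive_eq_smul` (the explicit factor `t`) this is the relative Poincaré
lemma of a product neighbourhood `N × (-δ, δ)` of a hypersurface used in Moser arguments
(McDuff–Salamon 2017, Lemma 3.2.1; Cannas da Silva–Guillemin–Woodward 2000, proof of Thm. 1: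
`μ = K(ω₀ - Ω)` with `dμ = ω₀ - Ω`, `μ = t μ̃`).  Everything here is proved; no definitions.

## References

* D. McDuff, D. Salamon, *Introduction to Symplectic Topology*, 3rd ed. (2017), §3.2.
  [McDuffSalamon2017]
* R. Bott, L. W. Tu, *Differential Forms in Algebraic Topology* (1982), §I.4. [BottTu1982Forms]
-/

noncomputable section

open scoped Topology ContDiff Manifold
open Set Filter MeasureTheory intervalIntegral ContinuousAlternatingMap
open Literature.Topology.FourManifolds

namespace Literature.Geometry.Kaehler

variable {m : ℕ} {F : Type*} [NormedAddCommGroup F] [NormedSpace ℝ F] {k : ℕ}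
variable {N : Type*} [TopologicalSpace N] [ChartedSpace (EuclideanSpace ℝ (Fin m)) N]

/-! ### The fibre primitive is smooth and a primitive (chart-wise transfer of the flat results) -/

section Transfer

variable [IsManifold (𝓡 m) ∞ N] [CompleteSpace F]

/-- The tangent coordinate change `τ = τ_{x → n}(n)` at a point of the chart source is invertible,
with inverse `τ_{n → x}(n)`. [folklore] -/
theorem exists_equiv_eq_tangentCoordChange {x n : N} (hn : n ∈ (extChartAt (𝓡 m) x).source) :
    ∃ e : EuclideanSpace ℝ (Fin m) ≃L[ℝ] EuclideanSpace ℝ (Fin m),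
      (e : EuclideanSpace ℝ (Fin m) →L[ℝ] EuclideanSpace ℝ (Fin m)) =
        tangentCoordChange (𝓡 m) x n n := by
  have h1 : ∀ v, tangentCoordChange (𝓡 m) n x n (tangentCoordChange (𝓡 m) x n n v) = v := fun v ↦ by
    rw [tangentCoordChange_comp ⟨⟨hn, mem_extChartAt_source n⟩, hn⟩]
    exact tangentCoordChange_self hn
  have h2 : ∀ v, tangentCoordChange (𝓡 m) x n n (tangentCoordChange (𝓡 m) n x n v) = v := fun v ↦ by
    rw [tangentCoordChange_comp ⟨⟨mem_extChartAt_source n, hn⟩, mem_extChartAt_source n⟩]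
    exact tangentCoordChange_self (mem_extChartAt_source n)
  exact ⟨ContinuousLinearEquiv.equivOfInverse _ _ h1 h2, rfl⟩

omit [IsManifold (𝓡 m) ∞ N] [CompleteSpace F] in
/-- Conjugation by `T = τ × id` of `k`-forms on the model, as a continuous linear equivalence,
passes through the interval integral with no integrability hypothesis. [folklore] -/
theorem intervalIntegral_compContinuousLinearMap_prodMap
    (e : EuclideanSpace ℝ (Fin m) ≃L[ℝ] EuclideanSpace ℝ (Fin m))
    (f : ℝ → (EuclideanSpace ℝ (Fin m) × ℝ) [⋀^Fin k]→L[ℝ] F) :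
    (∫ σ in (0 : ℝ)..1, f σ).compContinuousLinearMap
        ((e : EuclideanSpace ℝ (Fin m) →L[ℝ] EuclideanSpace ℝ (Fin m)).prodMap (ContinuousLinearMap.id ℝ ℝ)) =
      ∫ σ in (0 : ℝ)..1, (f σ).compContinuousLinearMap
        ((e : EuclideanSpace ℝ (Fin m) →L[ℝ] EuclideanSpace ℝ (Fin m)).prodMap (ContinuousLinearMap.id ℝ ℝ)) := by
  set T : (EuclideanSpace ℝ (Fin m) × ℝ) ≃L[ℝ] (EuclideanSpace ℝ (Fin m) × ℝ) :=
    e.prodCongr (ContinuousLinearEquiv.refl ℝ ℝ) with hT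
  set L := (T.symm.continuousAlternatingMapCongrLeft (ι := Fin k) (F := F) (𝕜 := ℝ)) with hL
  have hLapply : ∀ A : (EuclideanSpace ℝ (Fin m) × ℝ) [⋀^Fin k]→L[ℝ] F, L A =
      A.compContinuousLinearMap ((e : EuclideanSpace ℝ (Fin m) →L[ℝ] EuclideanSpace ℝ (Fin m)).prodMap
        (ContinuousLinearMap.id ℝ ℝ)) := by
    intro A
    rw [hL, ContinuousLinearEquiv.continuousAlternatingMapCongrLeft_apply, ContinuousLinearEquiv.symm_symm]
    rfl
  rw [← hLapply]
  simp only [← hLapply]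
  rw [intervalIntegral.integral_of_le zero_le_one, intervalIntegral.integral_of_le zero_le_one]
  exact (ContinuousLinearEquiv.integral_comp_comm L _).symm

omit [CompleteSpace F] in
/-- **In a product chart the fibre primitive is the flat operator of the representative**
(integrability-free form of `inChart_fibrePrimitive`). [folklore] -/
theorem inChart_fibrePrimitive_eq (η : MForm ((𝓡 m).prod 𝓘(ℝ, ℝ)) (N × ℝ) F (k + 1)) {x₀ : N × ℝ}
    {y : EuclideanSpace ℝ (Fin m) × ℝ} (hy : y ∈ (extChartAt ((𝓡 m).prod 𝓘(ℝ, ℝ)) x₀).target) :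
    (fibrePrimitive η).inChart x₀ y = linHomOperator (vertQ m) (η.inChart x₀) y := by
  have hy1 : y.1 ∈ (extChartAt (𝓡 m) x₀.1).target := mem_extChartAt_prod_real_target.1 hy
  set n : N := (extChartAt (𝓡 m) x₀.1).symm y.1 with hn
  have hns : n ∈ (extChartAt (𝓡 m) x₀.1).source := (extChartAt (𝓡 m) x₀.1).map_target hy1
  obtain ⟨e, he⟩ := exists_equiv_eq_tangentCoordChange hns
  have hT : ∀ s : ℝ, tangentCoordChange ((𝓡 m).prod 𝓘(ℝ, ℝ)) x₀ ((n, s) : N × ℝ) (n, s) =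
      (e : EuclideanSpace ℝ (Fin m) →L[ℝ] EuclideanSpace ℝ (Fin m)).prodMap (ContinuousLinearMap.id ℝ ℝ) := fun s ↦ by
    rw [tangentCoordChange_prod_real (mem_extChartAt_prod_real_source.2 hns), he]
  have hsymm : ∀ s : ℝ, (extChartAt ((𝓡 m).prod 𝓘(ℝ, ℝ)) x₀).symm (y.1, s) = (n, s) := fun s ↦ by
    rw [extChartAt_prod_real_symm_eq]
  have hmem : ∀ s : ℝ, ((y.1, s) : EuclideanSpace ℝ (Fin m) × ℝ) ∈
      (extChartAt ((𝓡 m).prod 𝓘(ℝ, ℝ)) x₀).target := fun s ↦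
    mem_extChartAt_prod_real_target.2 hy1
  have hy' : y = (y.1, y.2) := rfl
  rw [MForm.inChart_eq_of_mem_target _ hy]
  conv_lhs => rw [hy', hsymm y.2, hT y.2]
  rw [fibrePrimitive_apply]
  have hswap := intervalIntegral_compContinuousLinearMap_prodMap (k := k) (F := F) e
    (fun σ : ℝ ↦ (((η (n, σ * y.2) :
      (EuclideanSpace ℝ (Fin m) × ℝ) [⋀^Fin (k + 1)]→L[ℝ] F)).curryLeft
        (((0 : EuclideanSpace ℝ (Fin m)), y.2) : EuclideanSpace ℝ (Fin m) × ℝ)).compContinuousLinearMap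
        (linHom (vertQ m) σ))
  refine (Eq.trans (by rfl) hswap).trans ?_
  simp only [linHomOperator, linHomIntegrand, linHom_vertQ_apply, vertQ_apply]
  refine congrArg (fun f : ℝ → (EuclideanSpace ℝ (Fin m) × ℝ) [⋀^Fin k]→L[ℝ] F ↦
    ∫ σ in (0 : ℝ)..1, f σ) (funext fun σ ↦ ?_)
  rw [MForm.inChart_eq_of_mem_target _ (hmem (σ * y.2)), hsymm, hT]
  exact (curryLeft_compContinuousLinearMap_prodMap (η (n, σ * y.2)) (e : EuclideanSpace ℝ (Fin m) →L[ℝ] EuclideanSpace ℝ (Fin m)) σ y.2).symm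

variable {J : Set ℝ}

/-- The open set `target × J` of the model is fibre-star-shaped for the vertical part when `J`
is star-shaped at `0`. [folklore] -/
theorem linHom_vertQ_mem_prod (hJst : ∀ s ∈ J, ∀ σ ∈ Icc (0 : ℝ) 1, σ * s ∈ J)
    {W : Set (EuclideanSpace ℝ (Fin m))} {p : EuclideanSpace ℝ (Fin m) × ℝ} (hp : p ∈ W ×ˢ J)
    (σ : ℝ) (hσ : σ ∈ Icc (0 : ℝ) 1) : linHom (vertQ m) σ p ∈ W ×ˢ J := by
  rw [linHom_vertQ_apply]
  exact ⟨hp.1, hJst _ hp.2 σ hσ⟩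

omit [CompleteSpace F] in
/-- The chart representative of a form smooth on `N × J` is `C^∞` on `target × J`. [folklore] -/
theorem contDiffOn_inChart_prod {η : MForm ((𝓡 m).prod 𝓘(ℝ, ℝ)) (N × ℝ) F (k + 1)}
    (hη : ∀ z : N × ℝ, z.2 ∈ J → η.SmoothAt z) (x₀ : N × ℝ) :
    ContDiffOn ℝ ∞ (η.inChart x₀) ((extChartAt (𝓡 m) x₀.1).target ×ˢ J) := by
  intro y hy
  have hyt : y ∈ (extChartAt ((𝓡 m).prod 𝓘(ℝ, ℝ)) x₀).target :=
    mem_extChartAt_prod_real_target.2 hy.1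
  set z := (extChartAt ((𝓡 m).prod 𝓘(ℝ, ℝ)) x₀).symm y with hz
  have hzs : z ∈ (extChartAt ((𝓡 m).prod 𝓘(ℝ, ℝ)) x₀).source :=
    (extChartAt ((𝓡 m).prod 𝓘(ℝ, ℝ)) x₀).map_target hyt
  have hz2 : z.2 = y.2 := by rw [hz, extChartAt_prod_real_symm_eq]
  have hsm : η.SmoothAt z := hη z (hz2 ▸ hy.2)
  have h := MForm.SmoothAt.contDiffWithinAt_inChart hzs hsm
  rw [(extChartAt ((𝓡 m).prod 𝓘(ℝ, ℝ)) x₀).right_inv hyt, ModelWithCorners.Boundaryless.range_eq_univ]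
    at h
  exact h.mono (subset_univ _)

omit [CompleteSpace F] in
/-- **The fibre primitive of a form smooth on `N × J` is smooth on `N × J`** (`J` open,
star-shaped at `0`): in the product chart at `x₀` its representative is the flat operator of the
representative of `η` (`inChart_fibrePrimitive_eq`), which is `C^∞` on the fibre-star-shaped open
set `target × J` (`contDiffOn_linHomOperator`). [cite: McDuffSalamon2017, Lemma 3.2.1] -/
theorem smoothAt_fibrePrimitive {η : MForm ((𝓡 m).prod 𝓘(ℝ, ℝ)) (N × ℝ) F (k + 1)}
    (hJ : IsOpen J) (hJst : ∀ s ∈ J, ∀ σ ∈ Icc (0 : ℝ) 1, σ * s ∈ J)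
    (hη : ∀ z : N × ℝ, z.2 ∈ J → η.SmoothAt z) {x₀ : N × ℝ} (hx₀ : x₀.2 ∈ J) :
    (fibrePrimitive η).SmoothAt x₀ := by
  set U : Set (EuclideanSpace ℝ (Fin m) × ℝ) := (extChartAt (𝓡 m) x₀.1).target ×ˢ J with hU
  have hUo : IsOpen U := (isOpen_extChartAt_target (I := 𝓡 m) x₀.1).prod hJ
  have hK : ContDiffOn ℝ ∞ (linHomOperator (vertQ m) (η.inChart x₀)) U :=
    contDiffOn_linHomOperator (vertQ m) hUo (fun p hp σ hσ ↦ linHom_vertQ_mem_prod hJst hp σ hσ)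
      (contDiffOn_inChart_prod hη x₀)
  have hcentre : extChartAt ((𝓡 m).prod 𝓘(ℝ, ℝ)) x₀ x₀ ∈ U := by
    rw [extChartAt_prod]
    exact ⟨mem_extChartAt_target (I := 𝓡 m) x₀.1, by simpa using hx₀⟩
  have heq : ∀ y ∈ U, (fibrePrimitive η).inChart x₀ y = linHomOperator (vertQ m) (η.inChart x₀) y :=
    fun y hy ↦ inChart_fibrePrimitive_eq η (mem_extChartAt_prod_real_target.2 hy.1)
  have hμ : ContDiffOn ℝ ∞ ((fibrePrimitive η).inChart x₀) U := hK.congr heq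
  show ContDiffWithinAt ℝ ∞ ((fibrePrimitive η).inChart x₀) (range ((𝓡 m).prod 𝓘(ℝ, ℝ)))
    (extChartAt ((𝓡 m).prod 𝓘(ℝ, ℝ)) x₀ x₀)
  exact ((hμ _ hcentre).contDiffAt (hUo.mem_nhds hcentre)).contDiffWithinAt

/-- **The fibre primitive of a CLOSED form smooth on `N × J` and vanishing on `N × {0}` is a
primitive**: `d (fibrePrimitive η) = η` on `N × J` — the relative Poincaré lemma along the
`ℝ`-factor (McDuff–Salamon 2017, Lemma 3.2.1; Cannas da Silva–Guillemin–Woodward 2000, proof of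
Thm. 1), obtained chart-wise from `extDeriv_linHomOperator_of_closed_of_mapsTo`.
[cite: McDuffSalamon2017, Lemma 3.2.1] -/
theorem mextDeriv_fibrePrimitive {η : MForm ((𝓡 m).prod 𝓘(ℝ, ℝ)) (N × ℝ) F (k + 1)}
    (hJ : IsOpen J) (hJst : ∀ s ∈ J, ∀ σ ∈ Icc (0 : ℝ) 1, σ * s ∈ J)
    (hη : ∀ z : N × ℝ, z.2 ∈ J → η.SmoothAt z)
    (hcl : ∀ z : N × ℝ, z.2 ∈ J → mextDeriv η z = 0) (hzero : ∀ n : N, η (n, 0) = 0)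
    {x₀ : N × ℝ} (hx₀ : x₀.2 ∈ J) :
    mextDeriv (fibrePrimitive η) x₀ = η x₀ := by
  set U : Set (EuclideanSpace ℝ (Fin m) × ℝ) := (extChartAt (𝓡 m) x₀.1).target ×ˢ J with hU
  have hUo : IsOpen U := (isOpen_extChartAt_target (I := 𝓡 m) x₀.1).prod hJ
  have hst : ∀ p ∈ U, ∀ σ ∈ Icc (0 : ℝ) 1, linHom (vertQ m) σ p ∈ U :=
    fun p hp σ hσ ↦ linHom_vertQ_mem_prod hJst hp σ hσ
  have hβ : ContDiffOn ℝ ∞ (η.inChart x₀) U := contDiffOn_inChart_prod hη x₀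
  have hcentre : extChartAt ((𝓡 m).prod 𝓘(ℝ, ℝ)) x₀ x₀ ∈ U := by
    rw [extChartAt_prod]
    exact ⟨mem_extChartAt_target (I := 𝓡 m) x₀.1, by simpa using hx₀⟩
  have heq : ∀ y ∈ U, (fibrePrimitive η).inChart x₀ y = linHomOperator (vertQ m) (η.inChart x₀) y :=
    fun y hy ↦ inChart_fibrePrimitive_eq η (mem_extChartAt_prod_real_target.2 hy.1)
  -- `extDeriv` of the representative of `η` vanishes on `U` (chart formula for `d`, `dη = 0`)
  have hd : ∀ y ∈ U, extDeriv (η.inChart x₀) y = 0 := by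
    intro y hy
    have hyt : y ∈ (extChartAt ((𝓡 m).prod 𝓘(ℝ, ℝ)) x₀).target :=
      mem_extChartAt_prod_real_target.2 hy.1
    set z := (extChartAt ((𝓡 m).prod 𝓘(ℝ, ℝ)) x₀).symm y with hz
    have hz2 : z.2 = y.2 := by rw [hz, extChartAt_prod_real_symm_eq]
    have hzJ : z.2 ∈ J := hz2 ▸ hy.2
    have h := inChart_mextDeriv_of_mem_target η hyt (hη z hzJ)
    rw [ModelWithCorners.Boundaryless.range_eq_univ, extDerivWithin_univ] at h
    rw [← h, MForm.inChart_eq_of_mem_target _ hyt, hcl z hzJ]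
    exact ContinuousAlternatingMap.ext fun _ ↦ rfl
  -- `P^* (η.inChart x₀)` vanishes at `P y = (y.1, 0)` (`η = 0` on the zero section)
  have h0 : ∀ y ∈ U, ((η.inChart x₀)
      ((ContinuousLinearMap.id ℝ (EuclideanSpace ℝ (Fin m) × ℝ) - vertQ m) y)).compContinuousLinearMap
      (ContinuousLinearMap.id ℝ (EuclideanSpace ℝ (Fin m) × ℝ) - vertQ m) = 0 := by
    intro y hy
    have hP : (ContinuousLinearMap.id ℝ (EuclideanSpace ℝ (Fin m) × ℝ) - vertQ m) y = (y.1, (0 : ℝ)) :=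
      id_sub_inr_comp_snd_apply y
    have hyt : ((y.1, (0 : ℝ)) : EuclideanSpace ℝ (Fin m) × ℝ) ∈
        (extChartAt ((𝓡 m).prod 𝓘(ℝ, ℝ)) x₀).target := mem_extChartAt_prod_real_target.2 hy.1
    rw [hP, MForm.inChart_eq_of_mem_target _ hyt, extChartAt_prod_real_symm_eq]
    dsimp only
    rw [hzero]
    exact ContinuousAlternatingMap.ext fun _ ↦ rfl
  -- assemble at the centre of the chart
  rw [mextDeriv_eq_extDerivWithin, ModelWithCorners.Boundaryless.range_eq_univ, extDerivWithin_univ]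
  have hloc : extDeriv ((fibrePrimitive η).inChart x₀) (extChartAt ((𝓡 m).prod 𝓘(ℝ, ℝ)) x₀ x₀) =
      extDeriv (linHomOperator (vertQ m) (η.inChart x₀)) (extChartAt ((𝓡 m).prod 𝓘(ℝ, ℝ)) x₀ x₀) :=
    Filter.EventuallyEq.extDeriv_eq (Filter.eventually_of_mem (hUo.mem_nhds hcentre) heq)
  rw [hloc, extDeriv_linHomOperator_of_closed_of_mapsTo (vertQ m) hUo hst hβ hd h0 hcentre,
    MForm.inChart_apply_self]

end Transfer

end Literature.Geometry.Kaehler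

end
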